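import Summits.MatrixMultiplication.MatrixMultiplication.Theorems.SoloInformedValMixedImages

/-!
# The additive criterion for a union of any finite family of complete blocks

Solo-informed MatrixMultiplication, gen 83 (dossier `paper/val-superlinear.md` §15.8 (n); CLAIMS c610).

Setting: an abelian group `G`, identity potentials on `I = J = K = G`, a finite index set `T` and blocks
`X t × Y t × Z t` (`t ∈ T`); the pair graphs are the unions of the complete bipartite pieces,
`H_IJ = ⋃ X t × Y t`, `H_JK = ⋃ Y t × Z t`, `H_KI = ⋃ Z t × X t` (`famPairs`).

For a block index `a` put `M_a = X_a + Y_a − Z_a` (`mixedImage`), `U_a = X_a + ⋃_{b ≠ a} (Y_b − Z_b)` (`crossU`)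
and `V_a = Y_a + ⋃_{c ≠ a} (X_c − Z_c)` (`crossV`).  An accidental solution
`(i − j) + (j' − k) + (k' − i') = 0` with `(i, j)` from block `a`, `(j', k)` from block `b` and `(k', i')` from
block `c` is the same as a common element `i + (j' − k) = j + (i' − k')` of `X_a + (Y_b − Z_b)` and
`Y_a + (X_c − Z_c)`; sorting by whether `b = a` and whether `c = a` gives the

**Family criterion** (`FamilyCriterionAt`): block `a` has the additive TPP and `M_a, U_a, V_a` are pairwise
disjoint.
* `NoAccidental.of_familyCriterion`: the criterion at every `a ∈ T` implies accidental-freeness (no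
  disjointness hypotheses needed);
* `familyCriterion_of_noAccidental`: if the `Y t` are pairwise disjoint and the `Z t` are pairwise disjoint,
  accidental-freeness implies the criterion at every `a ∈ T`; `noAccidental_family_iff` combines the two;
* `FamilyCriterionAt.volume_add_card_crossU_add_card_crossV_le`: the MASTER PACKING INEQUALITY
  `|X_a||Y_a||Z_a| + |U_a| + |V_a| ≤ |G|`, which contains every packing inequality used for two and three blocks
  (`SoloInformedValTwoBlockU2NOverlap`, `SoloInformedValThreeBlockU2N`).

The criterion replaces the six-variable accidental equation (`|G|⁶` cases) by sumset computations, which is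
what makes machine certificates for explicit many-block configurations feasible.  Elementary; no `sorry`.
-/

namespace Summit.MatrixMultiplication.MatrixMultiplication.Theorems.SoloVal

open Finset

section FamilyCriterion

variable {G : Type*} [AddCommGroup G] [DecidableEq G]
variable {ι : Type*} [DecidableEq ι]

omit [DecidableEq ι] in
/-- The pair graph `⋃_{t ∈ T} A t × B t` of a family of complete bipartite pieces. -/
def famPairs (T : Finset ι) (A B : ι → Finset G) : Finset (G × G) :=
  T.biUnion fun t => A t ×ˢ B t

omit [AddCommGroup G] [DecidableEq ι] in
/-- Membership in `famPairs`: the pair lies in one of the pieces. -/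
theorem mem_famPairs {T : Finset ι} {A B : ι → Finset G} {u v : G} :
    (u, v) ∈ famPairs T A B ↔ ∃ t ∈ T, u ∈ A t ∧ v ∈ B t := by
  simp [famPairs, Finset.mem_biUnion, Finset.mem_product]

/-- The difference set `A − B`. -/
def diffSet (A B : Finset G) : Finset G :=
  (A ×ˢ B).image fun p => p.1 - p.2

/-- Membership in a difference set. -/
theorem mem_diffSet {A B : Finset G} {d : G} :
    d ∈ diffSet A B ↔ ∃ a ∈ A, ∃ b ∈ B, a - b = d := by
  unfold diffSet
  constructor
  · intro hd
    obtain ⟨⟨a, b⟩, hm, h⟩ := Finset.mem_image.mp hd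
    rw [Finset.mem_product] at hm
    exact ⟨a, hm.1, b, hm.2, h⟩
  · rintro ⟨a, ha, b, hb, h⟩
    exact Finset.mem_image.mpr ⟨(a, b), Finset.mem_product.mpr ⟨ha, hb⟩, h⟩

/-- The sumset `A + B`. -/
def sumSet (A B : Finset G) : Finset G :=
  (A ×ˢ B).image fun p => p.1 + p.2

/-- Membership in a sumset. -/
theorem mem_sumSet {A B : Finset G} {g : G} :
    g ∈ sumSet A B ↔ ∃ a ∈ A, ∃ b ∈ B, a + b = g := by
  unfold sumSet
  constructor
  · intro hg
    obtain ⟨⟨a, b⟩, hm, h⟩ := Finset.mem_image.mp hg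
    rw [Finset.mem_product] at hm
    exact ⟨a, hm.1, b, hm.2, h⟩
  · rintro ⟨a, ha, b, hb, h⟩
    exact Finset.mem_image.mpr ⟨(a, b), Finset.mem_product.mpr ⟨ha, hb⟩, h⟩

/-- `U_a = X_a + ⋃_{b ∈ T, b ≠ a} (Y_b − Z_b)`: the `X_a`-translates of the other blocks' `JK`-differences. -/
def crossU (T : Finset ι) (X Y Z : ι → Finset G) (a : ι) : Finset G :=
  sumSet (X a) ((T.erase a).biUnion fun b => diffSet (Y b) (Z b))

/-- `V_a = Y_a + ⋃_{c ∈ T, c ≠ a} (X_c − Z_c)`: the `Y_a`-translates of the other blocks' `KI`-differences. -/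
def crossV (T : Finset ι) (X Y Z : ι → Finset G) (a : ι) : Finset G :=
  sumSet (Y a) ((T.erase a).biUnion fun c => diffSet (X c) (Z c))

variable {T : Finset ι} {X Y Z : ι → Finset G} {a : ι}

/-- Membership in `U_a`. -/
theorem mem_crossU {g : G} :
    g ∈ crossU T X Y Z a ↔ ∃ x ∈ X a, ∃ b ∈ T.erase a, ∃ y ∈ Y b, ∃ z ∈ Z b, x + (y - z) = g := by
  unfold crossU
  rw [mem_sumSet]
  constructor
  · rintro ⟨x, hx, d, hd, h⟩
    obtain ⟨b, hb, hdb⟩ := Finset.mem_biUnion.mp hd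
    obtain ⟨y, hy, z, hz, rfl⟩ := mem_diffSet.mp hdb
    exact ⟨x, hx, b, hb, y, hy, z, hz, h⟩
  · rintro ⟨x, hx, b, hb, y, hy, z, hz, h⟩
    exact ⟨x, hx, y - z, Finset.mem_biUnion.mpr ⟨b, hb, mem_diffSet.mpr ⟨y, hy, z, hz, rfl⟩⟩, h⟩

/-- Membership in `V_a`. -/
theorem mem_crossV {g : G} :
    g ∈ crossV T X Y Z a ↔ ∃ y ∈ Y a, ∃ c ∈ T.erase a, ∃ x ∈ X c, ∃ z ∈ Z c, y + (x - z) = g := by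
  unfold crossV
  rw [mem_sumSet]
  constructor
  · rintro ⟨y, hy, d, hd, h⟩
    obtain ⟨c, hc, hdc⟩ := Finset.mem_biUnion.mp hd
    obtain ⟨x, hx, z, hz, rfl⟩ := mem_diffSet.mp hdc
    exact ⟨y, hy, c, hc, x, hx, z, hz, h⟩
  · rintro ⟨y, hy, c, hc, x, hx, z, hz, h⟩
    exact ⟨y, hy, x - z, Finset.mem_biUnion.mpr ⟨c, hc, mem_diffSet.mpr ⟨x, hx, z, hz, rfl⟩⟩, h⟩

/-- THE FAMILY CRITERION at block `a`: the block has the additive TPP and `M_a = X_a + Y_a − Z_a`, `U_a`, `V_a`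
are pairwise disjoint. -/
def FamilyCriterionAt (T : Finset ι) (X Y Z : ι → Finset G) (a : ι) : Prop :=
  AddTPP (X a) (Y a) (Z a) ∧ Disjoint (mixedImage (X a) (Y a) (Z a)) (crossU T X Y Z a) ∧
    Disjoint (mixedImage (X a) (Y a) (Z a)) (crossV T X Y Z a) ∧
    Disjoint (crossU T X Y Z a) (crossV T X Y Z a)

/-- SUFFICIENCY: the family criterion at every block implies that the union of the blocks has no accidental
solutions (no disjointness hypotheses on the blocks are needed). -/
theorem NoAccidental.of_familyCriterion (h : ∀ a ∈ T, FamilyCriterionAt T X Y Z a) :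
    NoAccidental (id : G → G) id id (famPairs T X Y) (famPairs T Y Z) (famPairs T Z X) := by
  intro i j j' k k' i' hIJ hJK hKI h0
  obtain ⟨a, ha, hi, hj⟩ := mem_famPairs.mp hIJ
  obtain ⟨b, hb, hj', hk⟩ := mem_famPairs.mp hJK
  obtain ⟨c, hc, hk', hi'⟩ := mem_famPairs.mp hKI
  obtain ⟨hT, hMU, hMV, hUV⟩ := h a ha
  have h0' : (i - j) + (j' - k) + (k' - i') = 0 := h0
  -- the common element `g = i + (j' - k) = j + (i' - k')`
  have hg : i + (j' - k) = j + (i' - k') :=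
    calc i + (j' - k) = j + (i' - k') + ((i - j) + (j' - k) + (k' - i')) := by abel
      _ = j + (i' - k') := by rw [h0', add_zero]
  have hgM_of_b (hba : b = a) : i + (j' - k) ∈ mixedImage (X a) (Y a) (Z a) :=
    mem_mixedImage.mpr ⟨i, hi, j', hba ▸ hj', k, hba ▸ hk, add_sub_assoc i j' k⟩
  have hgM_of_c (hca : c = a) : i + (j' - k) ∈ mixedImage (X a) (Y a) (Z a) :=
    mem_mixedImage.mpr ⟨i', hca ▸ hi', j, hj, k', hca ▸ hk', by rw [hg]; abel⟩
  have hgU_of_b (hba : b ≠ a) : i + (j' - k) ∈ crossU T X Y Z a :=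
    mem_crossU.mpr ⟨i, hi, b, Finset.mem_erase.mpr ⟨hba, hb⟩, j', hj', k, hk, rfl⟩
  have hgV_of_c (hca : c ≠ a) : i + (j' - k) ∈ crossV T X Y Z a :=
    mem_crossV.mpr ⟨j, hj, c, Finset.mem_erase.mpr ⟨hca, hc⟩, i', hi', k', hk', hg.symm⟩
  by_cases hba : b = a
  · by_cases hca : c = a
    · exact hT hi (hca ▸ hi') hj (hba ▸ hj') (hba ▸ hk) (hca ▸ hk') h0'
    · exact absurd (hgV_of_c hca) (Finset.disjoint_left.mp hMV (hgM_of_b hba))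
  · by_cases hca : c = a
    · exact absurd (hgU_of_b hba) (Finset.disjoint_left.mp hMU (hgM_of_c hca))
    · exact absurd (hgV_of_c hca) (Finset.disjoint_left.mp hUV (hgU_of_b hba))

/-- NECESSITY: if the `Y t` (`t ∈ T`) are pairwise disjoint and the `Z t` are pairwise disjoint, an
accidental-free union of the blocks satisfies the family criterion at every block of the family. -/
theorem familyCriterion_of_noAccidental
    (hY : ∀ a ∈ T, ∀ b ∈ T, a ≠ b → Disjoint (Y a) (Y b))
    (hZ : ∀ a ∈ T, ∀ b ∈ T, a ≠ b → Disjoint (Z a) (Z b))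
    (hN : NoAccidental (id : G → G) id id (famPairs T X Y) (famPairs T Y Z) (famPairs T Z X))
    {a : ι} (ha : a ∈ T) : FamilyCriterionAt T X Y Z a := by
  refine ⟨?_, ?_, ?_, ?_⟩
  · -- the block on its own
    intro x hx x' hx' y hy y' hy' z hz z' hz' h0
    exact hN x y y' z z' x' (mem_famPairs.mpr ⟨a, ha, hx, hy⟩) (mem_famPairs.mpr ⟨a, ha, hy', hz⟩)
      (mem_famPairs.mpr ⟨a, ha, hz', hx'⟩) h0
  · -- `M_a ∩ U_a = ∅`: pattern `(a, b, a)` with `b ≠ a`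
    rw [Finset.disjoint_left]
    intro g hgM hgU
    obtain ⟨x, hx, y, hy, z, hz, hgx⟩ := mem_mixedImage.mp hgM
    obtain ⟨x₂, hx₂, b, hb, y₂, hy₂, z₂, hz₂, hgx₂⟩ := mem_crossU.mp hgU
    obtain ⟨hba, hbT⟩ := Finset.mem_erase.mp hb
    have h0 : (id x₂ - id y) + (id y₂ - id z₂) + (id z - id x) = (0 : G) := by
      simp only [id]
      calc (x₂ - y) + (y₂ - z₂) + (z - x) = (x₂ + (y₂ - z₂)) - (x + y - z) := by abel
        _ = 0 := by rw [hgx₂, hgx, sub_self]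
    obtain ⟨-, hyy₂, -⟩ := hN x₂ y y₂ z₂ z x (mem_famPairs.mpr ⟨a, ha, hx₂, hy⟩)
      (mem_famPairs.mpr ⟨b, hbT, hy₂, hz₂⟩) (mem_famPairs.mpr ⟨a, ha, hz, hx⟩) h0
    exact Finset.disjoint_left.mp (hY a ha b hbT (Ne.symm hba)) hy (by rw [hyy₂]; exact hy₂)
  · -- `M_a ∩ V_a = ∅`: pattern `(a, a, c)` with `c ≠ a`
    rw [Finset.disjoint_left]
    intro g hgM hgV
    obtain ⟨x, hx, y, hy, z, hz, hgx⟩ := mem_mixedImage.mp hgM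
    obtain ⟨y₂, hy₂, c, hc, x₂, hx₂, z₂, hz₂, hgy₂⟩ := mem_crossV.mp hgV
    obtain ⟨hca, hcT⟩ := Finset.mem_erase.mp hc
    have h0 : (id x - id y₂) + (id y - id z) + (id z₂ - id x₂) = (0 : G) := by
      simp only [id]
      calc (x - y₂) + (y - z) + (z₂ - x₂) = (x + y - z) - (y₂ + (x₂ - z₂)) := by abel
        _ = 0 := by rw [hgx, hgy₂, sub_self]
    obtain ⟨-, -, hzz₂⟩ := hN x y₂ y z z₂ x₂ (mem_famPairs.mpr ⟨a, ha, hx, hy₂⟩)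
      (mem_famPairs.mpr ⟨a, ha, hy, hz⟩) (mem_famPairs.mpr ⟨c, hcT, hz₂, hx₂⟩) h0
    exact Finset.disjoint_left.mp (hZ a ha c hcT (Ne.symm hca)) hz (by rw [hzz₂]; exact hz₂)
  · -- `U_a ∩ V_a = ∅`: pattern `(a, b, c)` with `b, c ≠ a`
    rw [Finset.disjoint_left]
    intro g hgU hgV
    obtain ⟨x, hx, b, hb, y₂, hy₂, z₂, hz₂, hgx⟩ := mem_crossU.mp hgU
    obtain ⟨y, hy, c, hc, x₃, hx₃, z₃, hz₃, hgy⟩ := mem_crossV.mp hgV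
    obtain ⟨hba, hbT⟩ := Finset.mem_erase.mp hb
    obtain ⟨-, hcT⟩ := Finset.mem_erase.mp hc
    have h0 : (id x - id y) + (id y₂ - id z₂) + (id z₃ - id x₃) = (0 : G) := by
      simp only [id]
      calc (x - y) + (y₂ - z₂) + (z₃ - x₃) = (x + (y₂ - z₂)) - (y + (x₃ - z₃)) := by abel
        _ = 0 := by rw [hgx, hgy, sub_self]
    obtain ⟨-, hyy₂, -⟩ := hN x y y₂ z₂ z₃ x₃ (mem_famPairs.mpr ⟨a, ha, hx, hy⟩)
      (mem_famPairs.mpr ⟨b, hbT, hy₂, hz₂⟩) (mem_famPairs.mpr ⟨c, hcT, hz₃, hx₃⟩) h0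
    exact Finset.disjoint_left.mp (hY a ha b hbT (Ne.symm hba)) hy (by rw [hyy₂]; exact hy₂)

/-- THE CRITERION: for blocks with pairwise disjoint `Y`-classes and pairwise disjoint `Z`-classes,
accidental-freeness of the union is equivalent to the family criterion at every block. -/
theorem noAccidental_family_iff
    (hY : ∀ a ∈ T, ∀ b ∈ T, a ≠ b → Disjoint (Y a) (Y b))
    (hZ : ∀ a ∈ T, ∀ b ∈ T, a ≠ b → Disjoint (Z a) (Z b)) :
    NoAccidental (id : G → G) id id (famPairs T X Y) (famPairs T Y Z) (famPairs T Z X) ↔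
      ∀ a ∈ T, FamilyCriterionAt T X Y Z a :=
  ⟨fun hN _ ha => familyCriterion_of_noAccidental hY hZ hN ha, NoAccidental.of_familyCriterion⟩

/-- A block with the additive TPP represents every element of `X + Y − Z` exactly once. -/
theorem AddTPP.card_mixedImage {X₀ Y₀ Z₀ : Finset G} (h : AddTPP X₀ Y₀ Z₀) :
    (mixedImage X₀ Y₀ Z₀).card = X₀.card * Y₀.card * Z₀.card := by
  have hinj : Set.InjOn (fun t : G × G × G => t.1 + t.2.1 - t.2.2) ↑(X₀ ×ˢ Y₀ ×ˢ Z₀) := by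
    rintro ⟨x, y, z⟩ hm ⟨x', y', z'⟩ hm' heq
    simp only [Finset.coe_product, Set.mem_prod, Finset.mem_coe] at hm hm'
    have heq' : x + y - z = x' + y' - z' := heq
    have h0 : (x - y') + (y - z) + (z' - x') = 0 :=
      calc (x - y') + (y - z) + (z' - x') = (x + y - z) - (x' + y' - z') := by abel
        _ = 0 := by rw [heq', sub_self]
    obtain ⟨hx, hy, hz⟩ := h hm.1 hm'.1 hm'.2.1 hm.2.1 hm.2.2 hm'.2.2 h0
    rw [hx, hy, hz]
  unfold mixedImage
  rw [Finset.card_image_of_injOn hinj, Finset.card_product, Finset.card_product, Nat.mul_assoc]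

/-- THE MASTER PACKING INEQUALITY: under the family criterion at `a`,
`|X_a||Y_a||Z_a| + |U_a| + |V_a| ≤ |G|`. -/
theorem FamilyCriterionAt.volume_add_card_crossU_add_card_crossV_le [Fintype G]
    (h : FamilyCriterionAt T X Y Z a) :
    (X a).card * (Y a).card * (Z a).card + (crossU T X Y Z a).card + (crossV T X Y Z a).card ≤
      Fintype.card G := by
  obtain ⟨hT, hMU, hMV, hUV⟩ := h
  rw [← hT.card_mixedImage, ← Finset.card_union_of_disjoint hMU,
    ← Finset.card_union_of_disjoint (Finset.disjoint_union_left.mpr ⟨hMV, hUV⟩)]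
  exact Finset.card_le_univ _

/-- The master inequality for an accidental-free family with pairwise disjoint `Y`- and `Z`-classes. -/
theorem NoAccidental.volume_add_card_crossU_add_card_crossV_le [Fintype G]
    (hY : ∀ a ∈ T, ∀ b ∈ T, a ≠ b → Disjoint (Y a) (Y b))
    (hZ : ∀ a ∈ T, ∀ b ∈ T, a ≠ b → Disjoint (Z a) (Z b))
    (hN : NoAccidental (id : G → G) id id (famPairs T X Y) (famPairs T Y Z) (famPairs T Z X))
    (ha : a ∈ T) :
    (X a).card * (Y a).card * (Z a).card + (crossU T X Y Z a).card + (crossV T X Y Z a).card ≤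
      Fintype.card G :=
  (familyCriterion_of_noAccidental hY hZ hN ha).volume_add_card_crossU_add_card_crossV_le

end FamilyCriterion

end Summit.MatrixMultiplication.MatrixMultiplication.Theorems.SoloVal
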